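import Mathlib
import HarnessLib
import Summits.HubbardSuperconductivity.HubbardSuperconductivity.Theorems.KLProgrammeKLRegimeEnginePairTransferDLineSupport
import Summits.HubbardSuperconductivity.HubbardSuperconductivity.Theorems.KLProgrammeKLRegimeEngineTwoShellLatticeMass

/-!
# Route `KLProgramme` — ENGINE child gen 8 (stmt-HubbardSuperconductivity-20437 `KLRegimeEngineV17F2`), skeleton v2 class #5 rev 3: the DIRECT `D`-line mass
# `WDd` of `klmd_defectDiff_le_masses_family` for a DEEP pair, ABOVE the small-transfer threshold — the two-shell law
# (cell gate-hubbard-kl, seat hubbard-kl-k3c2-p2 g16; KLTC-INDEX v10.3 §D rows «k3c2-p2»; companion of `…PairTransferDLineSupport`)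

WHY.  `…DLineSupport` shows that for a deep pair (`n + 2 ≤ j′ ≤ j`) the direct `D`-row vanishes when `G·|x − y|_𝕋 ≤ Λ(t)/6`.  At larger transfers each
summand is `|D(p)|·βL²/ρ(p) · |ẇ_{Λ(t)}(p′)|·βL²·‖ĝ_K(p′)‖` (+ the mirrored term) with `p′ = (ω_p, k + x − y)`: the slice factor is `≤ 128/(3Λ(t)²)`
(`|ẇ_Λ| ≤ (64/3)/Λ`, `‖ĝ_K‖ ≤ 2/Λ` on the band) and forces `|e_K(k + x − y)| ≤ Λ(t)`, while `D ≠ 0` forces `ρ(p) ≤ Λ_{j′}`; what is left is EXACTLY the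
`1/ρ`-weighted lattice two-shell mass of `…EngineTwoShellLatticeMass` at `(Λ′, ε₂) = (Λ_{j′}, Λ(t))` and transfer `∓(x − y)`:
* §1 the collapse of the partner sum (`sum_partner_ite_eq`: integer labels are injective), the summand's norm, the slice factor (`slice_factor_le`,
  `abs_nambuXiCT_le_of_slice_ne_zero`);
* §2 **`WDd_sum_le_twoShell`** — for `TwoShellFrameAreaAt A u` (`0 ≤ A`), `R.WF2`, `0 < U ≤ u R`, `μ ∈ klWindowC`, `FrameOK R U N μ K`, `0 < β`,
  `n + 2 ≤ j′ ≤ j`, `t ∈ [0,1]`, `Λₙ + Gδ ≤ klE0`, `0 < r ≤ |x − y|_𝕋`: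
  `WDd(t,x,y) ≤ (512/3)·(βL²)²/Λ(t)² · (9AL²/(2π²))·((Λ(t)+Gδ)/r + √(Λ(t)+Gδ))·[(βΛ_{j′}/π)(10 + 2Gβ/L) + 12Gβ/L]`
  — i.e. `(Λₙ−Λₙ₊₁)(βL²)⁻³·WDd ≲ A·(Λ(t)/|x−y|_𝕋 + √Λ(t))·(Λ_{j′}/Λₙ)`: the ROOM's `min(·, Λₙ₊₁/|k−k′|)` and `2⁻ⁿ` slots times `klIdxMass n j′`
  (`Λ_{j′}/Λₙ = 4^{−(j′−n)}`); `…_klTS` is the package instance.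
Plumbing over the two companions; nothing about the model's kernel sizes is asserted; nothing asserts (X).3, (c), K3 or superconductivity.  0 kit · 0 lit.
-/

noncomputable section

namespace Summit.HubbardSuperconductivity.HubbardSuperconductivity.Theorems.KLRegimeSplit

set_option linter.dupNamespace false -- summit = problem name (single-conjunct summit), D-0017

open Real Finset Set Literature.MathematicalPhysics.QuantumLattice Literature.Probability.LatticeModels
open Literature.MathematicalPhysics.QuantumLattice.FermiRG
open Summit.HubbardSuperconductivity.HubbardSuperconductivity.Theorems.KLProgrammeLegKernels
open Summit.HubbardSuperconductivity.HubbardSuperconductivity.Theorems.TwoPointAssembly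
open Summit.HubbardSuperconductivity.HubbardSuperconductivity.Theorems.DispersionFlow
open Summit.HubbardSuperconductivity.HubbardSuperconductivity.Theorems.KLRegimeWick
open Summit.HubbardSuperconductivity.HubbardSuperconductivity.Theorems.EngineV8

variable {L M : ℕ} (β μ : ℝ) (K : TrigPolyC4v)

/-! ## §1 Collapse of the partner sum, the summand's norm, the slice factor -/

omit K μ β in
/-- Integer labels of Matsubara indices are injective. -/
theorem matsubaraIdx_eq_of_matsubaraInt_eq {i j : MatsubaraIdx M} (h : matsubaraInt M i = matsubaraInt M j) : i = j := by
  simp only [matsubaraInt] at h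
  exact Fin.ext (by omega)

/-- **Collapse of the partner sum**: the direct row's constraint `m_{p′} + m₀ = m_p + m₀ ∧ k′ = k + x − y` singles out `p′ = (ω_p, k + x − y)`. -/
theorem sum_partner_ite_eq [NeZero L] [NeZero M] (x y : TorusSite 2 L) (p : FreqMomentum L M) (F : FreqMomentum L M → ℝ) :
    (∑ p' : FreqMomentum L M, if matsubaraInt M p'.1 + matsubaraInt M (omega0 M) = matsubaraInt M p.1 + matsubaraInt M (omega0 M) ∧ p'.2 = p.2 + x - y
      then F p' else 0) = F (p.1, p.2 + x - y) := by
  rw [Finset.sum_eq_single (p.1, p.2 + x - y)]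
  · simp
  · intro p' _ hne
    rw [if_neg]
    rintro ⟨h1, h2⟩
    apply hne
    have h1' : p'.1 = p.1 := matsubaraIdx_eq_of_matsubaraInt_eq (by linarith)
    exact Prod.ext h1' h2
  · intro h; exact absurd (Finset.mem_univ _) h

/-- The norm of one product of the masses door: `‖(a·(βL²ĝ(p)))·(b·(βL²ĝ(p′)))‖ = |a|·(βL²‖ĝ(p)‖)·(|b|·(βL²‖ĝ(p′)‖))` (`0 < β`). -/
theorem norm_weightProd_eq [NeZero L] {β : ℝ} (hβ : 0 < β) (μ : ℝ) (K : TrigPolyC4v) (a b : ℝ) (p p' : FreqMomentum L M) :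
    ‖(((a : ℝ) : ℂ) * (((β * (L : ℝ) ^ 2 : ℝ) : ℂ) * propCT L M β μ K p)) * (((b : ℝ) : ℂ) * (((β * (L : ℝ) ^ 2 : ℝ) : ℂ) * propCT L M β μ K p'))‖ =
      |a| * ((β * (L : ℝ) ^ 2) * ‖propCT L M β μ K p‖) * (|b| * ((β * (L : ℝ) ^ 2) * ‖propCT L M β μ K p'‖)) := by
  simp only [norm_mul, Complex.norm_real, Real.norm_eq_abs, abs_pow, abs_of_pos hβ, Nat.abs_cast]

/-- **The slice factor**: `|ẇ_Λ(p)|·‖ĝ_K(p)‖ ≤ 128/(3Λ²)` (`0 < Λ`; `ẇ_Λ ≠ 0` forces `ρ ≥ Λ/2`). -/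
theorem slice_factor_le [NeZero L] {Λ : ℝ} (hΛ : 0 < Λ) (p : FreqMomentum L M) :
    |deriv (fun Λ' : ℝ => hubbardCutoffWeightCT L M β μ K Λ' p) Λ| * ‖propCT L M β μ K p‖ ≤ 128 / (3 * Λ ^ 2) := by
  by_cases hW : deriv (fun Λ' : ℝ => hubbardCutoffWeightCT L M β μ K Λ' p) Λ = 0
  · rw [hW, abs_zero, zero_mul]; positivity
  · obtain ⟨hlo, -⟩ := radius_mem_of_slice_ne_zero β μ K hΛ.ne' p hW
    have h1 := klws_abs_deriv_cutoffWeight_scale_le L M β μ K hΛ.ne' p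
    rw [abs_of_pos hΛ] at h1
    have h2 : ‖propCT L M β μ K p‖ ≤ 2 / Λ := by
      rw [norm_propCT_eq]
      have hs : Λ / 2 ≤ Real.sqrt (matsubaraFreq β M p.1 ^ 2 + nambuXiCT L μ K p.2 ^ 2) := by
        rw [show Λ / 2 = Real.sqrt ((Λ / 2) ^ 2) by rw [Real.sqrt_sq (by positivity)]]
        exact Real.sqrt_le_sqrt (by linarith)
      rw [inv_eq_one_div, div_le_div_iff₀ (by linarith) hΛ]
      linarith
    calc _ ≤ 64 / 3 / Λ * (2 / Λ) := mul_le_mul h1 h2 (norm_nonneg _) (by positivity)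
      _ = 128 / (3 * Λ ^ 2) := by field_simp; ring

/-- On the slice line's support `|e_K(k)| ≤ Λ` (`0 < Λ`). -/
theorem abs_nambuXiCT_le_of_slice_ne_zero [NeZero L] {Λ : ℝ} (hΛ : 0 < Λ) (p : FreqMomentum L M)
    (hW : deriv (fun Λ' : ℝ => hubbardCutoffWeightCT L M β μ K Λ' p) Λ ≠ 0) : |nambuXiCT L μ K p.2| ≤ Λ := by
  obtain ⟨-, hhi⟩ := radius_mem_of_slice_ne_zero β μ K hΛ.ne' p hW
  exact abs_le_of_sq_le_sq' (by nlinarith [sq_nonneg (matsubaraFreq β M p.1)]) hΛ.le |> fun h => abs_le.2 h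

/-- **One product against the weighted two-shell indicator**: for a deep pair and `0 < Λ = Λ(t)`, with `p⁺ = (ω_p, k_p + q)`,
`|D(p)|·(βL²‖ĝ(p)‖)·(|ẇ_Λ(p⁺)|·(βL²‖ĝ(p⁺)‖)) ≤ (βL²)²·(128/(3Λ²))·[ρ(p)² ≤ Λ_{j′}² ∧ |e_K(k_p + q)| ≤ Λ]·ρ(p)⁻¹`. -/
theorem dirProd_le_indicator [NeZero L] {β : ℝ} (hβ : 0 < β) (μ : ℝ) (K : TrigPolyC4v) (n : ℕ) {j j' : ℕ} (hjj : j' ≤ j) {Λ : ℝ} (hΛ : 0 < Λ)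
    (q : TorusSite 2 L) (p : FreqMomentum L M) :
    |softSymbolCompl L M β μ K (n + 1) j p - softSymbolCompl L M β μ K (n + 1) j' p| * ((β * (L : ℝ) ^ 2) * ‖propCT L M β μ K p‖) *
        (|deriv (fun Λ' : ℝ => hubbardCutoffWeightCT L M β μ K Λ' (p.1, p.2 + q)) Λ| * ((β * (L : ℝ) ^ 2) * ‖propCT L M β μ K (p.1, p.2 + q)‖)) ≤
      (β * (L : ℝ) ^ 2) ^ 2 * (128 / (3 * Λ ^ 2)) *
        (if matsubaraFreq β M p.1 ^ 2 + nambuXiCT L μ K p.2 ^ 2 ≤ klScale klE0 j' ^ 2 ∧ |nambuXiCT L μ K (p.2 + q)| ≤ Λ then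
          (Real.sqrt (matsubaraFreq β M p.1 ^ 2 + nambuXiCT L μ K p.2 ^ 2))⁻¹ else 0) := by
  have hβL : 0 < β * (L : ℝ) ^ 2 := by
    have : (0 : ℝ) < L := by exact_mod_cast Nat.pos_of_ne_zero (NeZero.ne L)
    positivity
  by_cases hD : softSymbolCompl L M β μ K (n + 1) j p - softSymbolCompl L M β μ K (n + 1) j' p = 0
  · rw [hD, abs_zero, zero_mul, zero_mul]
    split_ifs <;> positivity
  by_cases hW : deriv (fun Λ' : ℝ => hubbardCutoffWeightCT L M β μ K Λ' (p.1, p.2 + q)) Λ = 0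
  · rw [hW, abs_zero, zero_mul, mul_zero]
    split_ifs <;> positivity
  have hrad := radius_lt_of_dLine_ne_zero β μ K n hjj p hD
  have he := abs_nambuXiCT_le_of_slice_ne_zero β μ K hΛ (p.1, p.2 + q) hW
  rw [if_pos ⟨hrad.le, he⟩]
  have h1 : |softSymbolCompl L M β μ K (n + 1) j p - softSymbolCompl L M β μ K (n + 1) j' p| ≤ 1 := abs_dLine_le_one β μ K n hjj p
  have h2 := slice_factor_le β μ K hΛ (p.1, p.2 + q)
  have h3 : ‖propCT L M β μ K p‖ = (Real.sqrt (matsubaraFreq β M p.1 ^ 2 + nambuXiCT L μ K p.2 ^ 2))⁻¹ := norm_propCT_eq (L := L) (M := M) (β := β) (μ := μ) (K := K) p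
  rw [← h3]
  have hn : 0 ≤ ‖propCT L M β μ K p‖ := norm_nonneg _
  calc _ = (|softSymbolCompl L M β μ K (n + 1) j p - softSymbolCompl L M β μ K (n + 1) j' p|) *
        (|deriv (fun Λ' : ℝ => hubbardCutoffWeightCT L M β μ K Λ' (p.1, p.2 + q)) Λ| * ‖propCT L M β μ K (p.1, p.2 + q)‖) *
          ((β * (L : ℝ) ^ 2) ^ 2 * ‖propCT L M β μ K p‖) := by ring
    _ ≤ 1 * (128 / (3 * Λ ^ 2)) * ((β * (L : ℝ) ^ 2) ^ 2 * ‖propCT L M β μ K p‖) := by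
        gcongr
    _ = _ := by ring

/-! ## §2 The direct `D`-row above threshold: the two-shell law -/

/-- **`WDd ≤` the weighted two-shell mass, for a deep pair.**  For `TwoShellFrameAreaAt A u` (`0 ≤ A`), `R.WF2`, `0 < U ≤ u R`, `μ ∈ klWindowC`,
`FrameOK R U N μ K`, `0 < β`, `n + 2 ≤ j′ ≤ j`, `t ∈ [0,1]`, `Λₙ + Gδ ≤ klE0` (`G = 4 + (8/3)Gfr₁U²`, `δ = 2π/L`) and `0 < r ≤ |x − y|_𝕋`:
`WDd(t,x,y) ≤ (512/3)·(βL²)²/Λ(t)²·(9AL²/(2π²))·((Λ(t)+Gδ)/r + √(Λ(t)+Gδ))·[(βΛ_{j′}/π)(10 + 2Gβ/L) + 12Gβ/L]`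
(the literal direct `D`-mass of `klmd_defectDiff_le_masses_family`). -/
theorem WDd_sum_le_twoShell [NeZero L] [NeZero M] {A : ℝ} {u : RenConsts → ℝ} (h : TwoShellFrameAreaAt A u) (hA : 0 ≤ A) {R : RenConsts}
    (hR : R.WF2) {U : ℝ} (hU : 0 < U) (hUu : U ≤ u R) (hμ : μ ∈ klWindowC) {N : ℕ} (hK : FrameOK R U N μ K) (hβ : 0 < β)
    (n : ℕ) {j j' : ℕ} (hj' : n + 2 ≤ j') (hjj : j' ≤ j) {t : ℝ} (ht : t ∈ Icc (0 : ℝ) 1)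
    (hE0 : klScale klE0 n + (4 + 8 / 3 * R.Gfr 1 * U ^ 2) * (2 * π / L) ≤ klE0) {x y : TorusSite 2 L} {r : ℝ} (hr : 0 < r)
    (hrw : r ≤ klTorusNorm L (x - y)) :
    ∑ p : FreqMomentum L M, ∑ _σ : Fin 2, ∑ p' : FreqMomentum L M,
      (if matsubaraInt M p'.1 + matsubaraInt M (omega0 M) = matsubaraInt M p.1 + matsubaraInt M (omega0 M) ∧ p'.2 = p.2 + x - y then
        ‖((((softSymbolCompl L M β μ K (n + 1) j p - softSymbolCompl L M β μ K (n + 1) j' p : ℝ)) : ℂ) * (((β * (L : ℝ) ^ 2 : ℝ) : ℂ) * propCT L M β μ K p)) *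
            ((((deriv (fun Λ' : ℝ => hubbardCutoffWeightCT L M β μ K Λ' p') (klScale klE0 n + t * (klScale klE0 (n + 1) - klScale klE0 n)) : ℝ)) : ℂ) *
              (((β * (L : ℝ) ^ 2 : ℝ) : ℂ) * propCT L M β μ K p')) +
          ((((deriv (fun Λ' : ℝ => hubbardCutoffWeightCT L M β μ K Λ' p) (klScale klE0 n + t * (klScale klE0 (n + 1) - klScale klE0 n)) : ℝ)) : ℂ) *
              (((β * (L : ℝ) ^ 2 : ℝ) : ℂ) * propCT L M β μ K p)) *
            ((((softSymbolCompl L M β μ K (n + 1) j p' - softSymbolCompl L M β μ K (n + 1) j' p' : ℝ)) : ℂ) * (((β * (L : ℝ) ^ 2 : ℝ) : ℂ) * propCT L M β μ K p'))‖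
      else 0) ≤
      512 / 3 * (β * (L : ℝ) ^ 2) ^ 2 / (klScale klE0 n + t * (klScale klE0 (n + 1) - klScale klE0 n)) ^ 2 *
        (9 * A * (L : ℝ) ^ 2 / (2 * π ^ 2) *
          (((klScale klE0 n + t * (klScale klE0 (n + 1) - klScale klE0 n)) + (4 + 8 / 3 * R.Gfr 1 * U ^ 2) * (2 * π / L)) / r +
            Real.sqrt ((klScale klE0 n + t * (klScale klE0 (n + 1) - klScale klE0 n)) + (4 + 8 / 3 * R.Gfr 1 * U ^ 2) * (2 * π / L))) *
          (β * klScale klE0 j' / π * (10 + 2 * (4 + 8 / 3 * R.Gfr 1 * U ^ 2) * β / L) + 12 * (4 + 8 / 3 * R.Gfr 1 * U ^ 2) * β / L)) := by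
  classical
  set Λ : ℝ := klScale klE0 n + t * (klScale klE0 (n + 1) - klScale klE0 n) with hΛdef
  have hΛ : 0 < Λ := scaleAt_pos n ht
  have hβL : 0 < β * (L : ℝ) ^ 2 := by
    have : (0 : ℝ) < L := by exact_mod_cast Nat.pos_of_ne_zero (NeZero.ne L)
    positivity
  set G : ℝ := 4 + 8 / 3 * R.Gfr 1 * U ^ 2 with hG
  set q : TorusSite 2 L := x - y with hq
  have hj'0 := klth_klScale_pos j'
  -- the weighted two-shell bound at `(Λ′, ε₂) = (Λ_{j′}, Λ)`
  have h2Λ : 2 * klScale klE0 j' ≤ Λ := by have := klScale_le_quarter_scaleAt hj' ht; rw [← hΛdef] at this; linarith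
  have hE : Λ + G * (2 * π / L) ≤ klE0 := by have := (scaleAt_mem n ht).2; rw [← hΛdef] at this; linarith
  set W : ℝ := 9 * A * (L : ℝ) ^ 2 / (2 * π ^ 2) * ((Λ + G * (2 * π / L)) / r + Real.sqrt (Λ + G * (2 * π / L))) *
      (β * klScale klE0 j' / π * (10 + 2 * G * β / L) + 12 * G * β / L) with hW
  have hWq : ∑ p ∈ univ.filter (fun p : FreqMomentum L M => matsubaraFreq β M p.1 ^ 2 + nambuXiCT L μ K p.2 ^ 2 ≤ klScale klE0 j' ^ 2 ∧
      |nambuXiCT L μ K (p.2 - q)| ≤ Λ), (Real.sqrt (matsubaraFreq β M p.1 ^ 2 + nambuXiCT L μ K p.2 ^ 2))⁻¹ ≤ W :=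
    twoShell_weighted_sum_le h hA hR hU hUu hμ hK hβ hj'0 h2Λ hE q hr hrw
  have hrw' : r ≤ klTorusNorm L (-q) := by rw [hq, neg_sub, klvr_klTorusNorm_sub_comm]; exact hrw
  have hWnq : ∑ p ∈ univ.filter (fun p : FreqMomentum L M => matsubaraFreq β M p.1 ^ 2 + nambuXiCT L μ K p.2 ^ 2 ≤ klScale klE0 j' ^ 2 ∧
      |nambuXiCT L μ K (p.2 - -q)| ≤ Λ), (Real.sqrt (matsubaraFreq β M p.1 ^ 2 + nambuXiCT L μ K p.2 ^ 2))⁻¹ ≤ W :=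
    twoShell_weighted_sum_le h hA hR hU hUu hμ hK hβ hj'0 h2Λ hE (-q) hr hrw'
  -- abbreviations for the two weights
  set D : FreqMomentum L M → ℝ := fun p => softSymbolCompl L M β μ K (n + 1) j p - softSymbolCompl L M β μ K (n + 1) j' p with hDdef
  set Wd : FreqMomentum L M → ℝ := fun p => deriv (fun Λ' : ℝ => hubbardCutoffWeightCT L M β μ K Λ' p) Λ with hWddef
  -- step 1: collapse the partner sum and the spin sum
  have hcollapse : ∀ p : FreqMomentum L M,
      (∑ _σ : Fin 2, ∑ p' : FreqMomentum L M,
        (if matsubaraInt M p'.1 + matsubaraInt M (omega0 M) = matsubaraInt M p.1 + matsubaraInt M (omega0 M) ∧ p'.2 = p.2 + x - y then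
          ‖(((D p : ℝ) : ℂ) * (((β * (L : ℝ) ^ 2 : ℝ) : ℂ) * propCT L M β μ K p)) * (((Wd p' : ℝ) : ℂ) * (((β * (L : ℝ) ^ 2 : ℝ) : ℂ) * propCT L M β μ K p')) +
            (((Wd p : ℝ) : ℂ) * (((β * (L : ℝ) ^ 2 : ℝ) : ℂ) * propCT L M β μ K p)) * (((D p' : ℝ) : ℂ) * (((β * (L : ℝ) ^ 2 : ℝ) : ℂ) * propCT L M β μ K p'))‖
        else 0)) =
      2 * ‖(((D p : ℝ) : ℂ) * (((β * (L : ℝ) ^ 2 : ℝ) : ℂ) * propCT L M β μ K p)) *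
            (((Wd (p.1, p.2 + q) : ℝ) : ℂ) * (((β * (L : ℝ) ^ 2 : ℝ) : ℂ) * propCT L M β μ K (p.1, p.2 + q))) +
          (((Wd p : ℝ) : ℂ) * (((β * (L : ℝ) ^ 2 : ℝ) : ℂ) * propCT L M β μ K p)) *
            (((D (p.1, p.2 + q) : ℝ) : ℂ) * (((β * (L : ℝ) ^ 2 : ℝ) : ℂ) * propCT L M β μ K (p.1, p.2 + q)))‖ := by
    intro p
    rw [sum_partner_ite_eq x y p, Finset.sum_const, Finset.card_univ, Fintype.card_fin, nsmul_eq_mul]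
    have e : p.2 + x - y = p.2 + q := by rw [hq]; abel
    rw [e]
    norm_num
  -- step 2: the two products against the indicators
  have hT : ∀ p : FreqMomentum L M,
      ‖(((D p : ℝ) : ℂ) * (((β * (L : ℝ) ^ 2 : ℝ) : ℂ) * propCT L M β μ K p)) *
            (((Wd (p.1, p.2 + q) : ℝ) : ℂ) * (((β * (L : ℝ) ^ 2 : ℝ) : ℂ) * propCT L M β μ K (p.1, p.2 + q))) +
          (((Wd p : ℝ) : ℂ) * (((β * (L : ℝ) ^ 2 : ℝ) : ℂ) * propCT L M β μ K p)) *
            (((D (p.1, p.2 + q) : ℝ) : ℂ) * (((β * (L : ℝ) ^ 2 : ℝ) : ℂ) * propCT L M β μ K (p.1, p.2 + q)))‖ ≤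
      (β * (L : ℝ) ^ 2) ^ 2 * (128 / (3 * Λ ^ 2)) *
        (if matsubaraFreq β M p.1 ^ 2 + nambuXiCT L μ K p.2 ^ 2 ≤ klScale klE0 j' ^ 2 ∧ |nambuXiCT L μ K (p.2 + q)| ≤ Λ then
          (Real.sqrt (matsubaraFreq β M p.1 ^ 2 + nambuXiCT L μ K p.2 ^ 2))⁻¹ else 0) +
      (β * (L : ℝ) ^ 2) ^ 2 * (128 / (3 * Λ ^ 2)) *
        (if matsubaraFreq β M (p.1, p.2 + q).1 ^ 2 + nambuXiCT L μ K (p.1, p.2 + q).2 ^ 2 ≤ klScale klE0 j' ^ 2 ∧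
            |nambuXiCT L μ K ((p.1, p.2 + q).2 + -q)| ≤ Λ then
          (Real.sqrt (matsubaraFreq β M (p.1, p.2 + q).1 ^ 2 + nambuXiCT L μ K (p.1, p.2 + q).2 ^ 2))⁻¹ else 0) := by
    intro p
    refine (norm_add_le _ _).trans (add_le_add ?_ ?_)
    · rw [norm_weightProd_eq hβ]
      exact dirProd_le_indicator hβ μ K n hjj hΛ q p
    · rw [norm_weightProd_eq hβ]
      have h := dirProd_le_indicator hβ μ K n hjj hΛ (-q) (p.1, p.2 + q)
      have e : (p.1, p.2 + q).2 + -q = p.2 := by simp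
      simp only [e] at h ⊢
      calc |Wd p| * ((β * (L : ℝ) ^ 2) * ‖propCT L M β μ K p‖) * (|D (p.1, p.2 + q)| * ((β * (L : ℝ) ^ 2) * ‖propCT L M β μ K (p.1, p.2 + q)‖))
          = |D (p.1, p.2 + q)| * ((β * (L : ℝ) ^ 2) * ‖propCT L M β μ K (p.1, p.2 + q)‖) * (|Wd (p.1, p.2)| * ((β * (L : ℝ) ^ 2) * ‖propCT L M β μ K (p.1, p.2)‖)) := by
            simp only [Prod.mk.eta]; ring
        _ ≤ _ := h
  -- step 3: sum, and recognise the two weighted two-shell masses (the second after the shift `k ↦ k + q`)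
  have hS1 : ∑ p : FreqMomentum L M,
      (if matsubaraFreq β M p.1 ^ 2 + nambuXiCT L μ K p.2 ^ 2 ≤ klScale klE0 j' ^ 2 ∧ |nambuXiCT L μ K (p.2 + q)| ≤ Λ then
          (Real.sqrt (matsubaraFreq β M p.1 ^ 2 + nambuXiCT L μ K p.2 ^ 2))⁻¹ else 0) ≤ W := by
    rw [← Finset.sum_filter]
    have e : (univ.filter fun p : FreqMomentum L M => matsubaraFreq β M p.1 ^ 2 + nambuXiCT L μ K p.2 ^ 2 ≤ klScale klE0 j' ^ 2 ∧
        |nambuXiCT L μ K (p.2 + q)| ≤ Λ) = univ.filter fun p : FreqMomentum L M => matsubaraFreq β M p.1 ^ 2 + nambuXiCT L μ K p.2 ^ 2 ≤ klScale klE0 j' ^ 2 ∧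
        |nambuXiCT L μ K (p.2 - -q)| ≤ Λ := by
      congr 1; funext p; rw [sub_neg_eq_add]
    rw [e]; exact hWnq
  have hS2 : ∑ p : FreqMomentum L M,
      (if matsubaraFreq β M (p.1, p.2 + q).1 ^ 2 + nambuXiCT L μ K (p.1, p.2 + q).2 ^ 2 ≤ klScale klE0 j' ^ 2 ∧
            |nambuXiCT L μ K ((p.1, p.2 + q).2 + -q)| ≤ Λ then
          (Real.sqrt (matsubaraFreq β M (p.1, p.2 + q).1 ^ 2 + nambuXiCT L μ K (p.1, p.2 + q).2 ^ 2))⁻¹ else 0) ≤ W := by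
    set g : FreqMomentum L M → ℝ := fun p' => if matsubaraFreq β M p'.1 ^ 2 + nambuXiCT L μ K p'.2 ^ 2 ≤ klScale klE0 j' ^ 2 ∧
        |nambuXiCT L μ K (p'.2 + -q)| ≤ Λ then (Real.sqrt (matsubaraFreq β M p'.1 ^ 2 + nambuXiCT L μ K p'.2 ^ 2))⁻¹ else 0 with hg
    set e : FreqMomentum L M ≃ FreqMomentum L M := Equiv.prodCongr (Equiv.refl _) (Equiv.addRight q) with hedef
    have hsum : ∑ p : FreqMomentum L M, g (e p) = ∑ p : FreqMomentum L M, g p := Equiv.sum_comp e g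
    have e1 : ∀ p : FreqMomentum L M, e p = (p.1, p.2 + q) := fun p => rfl
    simp only [e1, hg] at hsum
    rw [hsum, ← Finset.sum_filter]
    have e2 : (univ.filter fun p : FreqMomentum L M => matsubaraFreq β M p.1 ^ 2 + nambuXiCT L μ K p.2 ^ 2 ≤ klScale klE0 j' ^ 2 ∧
        |nambuXiCT L μ K (p.2 + -q)| ≤ Λ) = univ.filter fun p : FreqMomentum L M => matsubaraFreq β M p.1 ^ 2 + nambuXiCT L μ K p.2 ^ 2 ≤ klScale klE0 j' ^ 2 ∧
        |nambuXiCT L μ K (p.2 - q)| ≤ Λ := by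
      congr 1; funext p; rw [← sub_eq_add_neg]
    rw [e2]; exact hWq
  -- assemble
  have hc : 0 ≤ (β * (L : ℝ) ^ 2) ^ 2 * (128 / (3 * Λ ^ 2)) := by positivity
  calc _ = ∑ p : FreqMomentum L M, 2 * ‖(((D p : ℝ) : ℂ) * (((β * (L : ℝ) ^ 2 : ℝ) : ℂ) * propCT L M β μ K p)) *
            (((Wd (p.1, p.2 + q) : ℝ) : ℂ) * (((β * (L : ℝ) ^ 2 : ℝ) : ℂ) * propCT L M β μ K (p.1, p.2 + q))) +
          (((Wd p : ℝ) : ℂ) * (((β * (L : ℝ) ^ 2 : ℝ) : ℂ) * propCT L M β μ K p)) *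
            (((D (p.1, p.2 + q) : ℝ) : ℂ) * (((β * (L : ℝ) ^ 2 : ℝ) : ℂ) * propCT L M β μ K (p.1, p.2 + q)))‖ := Finset.sum_congr rfl fun p _ => hcollapse p
    _ ≤ ∑ p : FreqMomentum L M, 2 * ((β * (L : ℝ) ^ 2) ^ 2 * (128 / (3 * Λ ^ 2)) *
        (if matsubaraFreq β M p.1 ^ 2 + nambuXiCT L μ K p.2 ^ 2 ≤ klScale klE0 j' ^ 2 ∧ |nambuXiCT L μ K (p.2 + q)| ≤ Λ then
          (Real.sqrt (matsubaraFreq β M p.1 ^ 2 + nambuXiCT L μ K p.2 ^ 2))⁻¹ else 0) +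
      (β * (L : ℝ) ^ 2) ^ 2 * (128 / (3 * Λ ^ 2)) *
        (if matsubaraFreq β M (p.1, p.2 + q).1 ^ 2 + nambuXiCT L μ K (p.1, p.2 + q).2 ^ 2 ≤ klScale klE0 j' ^ 2 ∧
            |nambuXiCT L μ K ((p.1, p.2 + q).2 + -q)| ≤ Λ then
          (Real.sqrt (matsubaraFreq β M (p.1, p.2 + q).1 ^ 2 + nambuXiCT L μ K (p.1, p.2 + q).2 ^ 2))⁻¹ else 0)) :=
        Finset.sum_le_sum fun p _ => mul_le_mul_of_nonneg_left (hT p) (by norm_num)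
    _ = 2 * ((β * (L : ℝ) ^ 2) ^ 2 * (128 / (3 * Λ ^ 2))) * (∑ p : FreqMomentum L M,
        (if matsubaraFreq β M p.1 ^ 2 + nambuXiCT L μ K p.2 ^ 2 ≤ klScale klE0 j' ^ 2 ∧ |nambuXiCT L μ K (p.2 + q)| ≤ Λ then
          (Real.sqrt (matsubaraFreq β M p.1 ^ 2 + nambuXiCT L μ K p.2 ^ 2))⁻¹ else 0) +
        ∑ p : FreqMomentum L M, (if matsubaraFreq β M (p.1, p.2 + q).1 ^ 2 + nambuXiCT L μ K (p.1, p.2 + q).2 ^ 2 ≤ klScale klE0 j' ^ 2 ∧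
            |nambuXiCT L μ K ((p.1, p.2 + q).2 + -q)| ≤ Λ then
          (Real.sqrt (matsubaraFreq β M (p.1, p.2 + q).1 ^ 2 + nambuXiCT L μ K (p.1, p.2 + q).2 ^ 2))⁻¹ else 0)) := by
        rw [← Finset.sum_add_distrib, Finset.mul_sum]
        exact Finset.sum_congr rfl fun p _ => by ring
    _ ≤ 2 * ((β * (L : ℝ) ^ 2) ^ 2 * (128 / (3 * Λ ^ 2))) * (W + W) := by gcongr
    _ = 512 / 3 * (β * (L : ℝ) ^ 2) ^ 2 / Λ ^ 2 * W := by field_simp; ring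

/-- **The package instance** (`A = klTS`, `u = klTSU`). -/
theorem WDd_sum_le_twoShell_klTS [NeZero L] [NeZero M] {R : RenConsts} (hR : R.WF2) {U : ℝ} (hU : 0 < U) (hUu : U ≤ klTSU R)
    (hμ : μ ∈ klWindowC) {N : ℕ} (hK : FrameOK R U N μ K) (hβ : 0 < β) (n : ℕ) {j j' : ℕ} (hj' : n + 2 ≤ j') (hjj : j' ≤ j) {t : ℝ}
    (ht : t ∈ Icc (0 : ℝ) 1) (hE0 : klScale klE0 n + (4 + 8 / 3 * R.Gfr 1 * U ^ 2) * (2 * π / L) ≤ klE0) {x y : TorusSite 2 L} {r : ℝ}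
    (hr : 0 < r) (hrw : r ≤ klTorusNorm L (x - y)) :
    ∑ p : FreqMomentum L M, ∑ _σ : Fin 2, ∑ p' : FreqMomentum L M,
      (if matsubaraInt M p'.1 + matsubaraInt M (omega0 M) = matsubaraInt M p.1 + matsubaraInt M (omega0 M) ∧ p'.2 = p.2 + x - y then
        ‖((((softSymbolCompl L M β μ K (n + 1) j p - softSymbolCompl L M β μ K (n + 1) j' p : ℝ)) : ℂ) * (((β * (L : ℝ) ^ 2 : ℝ) : ℂ) * propCT L M β μ K p)) *
            ((((deriv (fun Λ' : ℝ => hubbardCutoffWeightCT L M β μ K Λ' p') (klScale klE0 n + t * (klScale klE0 (n + 1) - klScale klE0 n)) : ℝ)) : ℂ) *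
              (((β * (L : ℝ) ^ 2 : ℝ) : ℂ) * propCT L M β μ K p')) +
          ((((deriv (fun Λ' : ℝ => hubbardCutoffWeightCT L M β μ K Λ' p) (klScale klE0 n + t * (klScale klE0 (n + 1) - klScale klE0 n)) : ℝ)) : ℂ) *
              (((β * (L : ℝ) ^ 2 : ℝ) : ℂ) * propCT L M β μ K p)) *
            ((((softSymbolCompl L M β μ K (n + 1) j p' - softSymbolCompl L M β μ K (n + 1) j' p' : ℝ)) : ℂ) * (((β * (L : ℝ) ^ 2 : ℝ) : ℂ) * propCT L M β μ K p'))‖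
      else 0) ≤
      512 / 3 * (β * (L : ℝ) ^ 2) ^ 2 / (klScale klE0 n + t * (klScale klE0 (n + 1) - klScale klE0 n)) ^ 2 *
        (9 * klTS * (L : ℝ) ^ 2 / (2 * π ^ 2) *
          (((klScale klE0 n + t * (klScale klE0 (n + 1) - klScale klE0 n)) + (4 + 8 / 3 * R.Gfr 1 * U ^ 2) * (2 * π / L)) / r +
            Real.sqrt ((klScale klE0 n + t * (klScale klE0 (n + 1) - klScale klE0 n)) + (4 + 8 / 3 * R.Gfr 1 * U ^ 2) * (2 * π / L))) *
          (β * klScale klE0 j' / π * (10 + 2 * (4 + 8 / 3 * R.Gfr 1 * U ^ 2) * β / L) + 12 * (4 + 8 / 3 * R.Gfr 1 * U ^ 2) * β / L)) :=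
  WDd_sum_le_twoShell β μ K twoShellFrameAreaAt_klTS klTS_nonneg hR hU hUu hμ hK hβ n hj' hjj ht hE0 hr hrw

end Summit.HubbardSuperconductivity.HubbardSuperconductivity.Theorems.KLRegimeSplit

end
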